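import Summits.QuantumFields.YangMills.Theorems.FluctuationComparisonRegPrIntLS2BetaRelativeOneLevelStepHist
import Summits.QuantumFields.YangMills.Theorems.FluctuationComparisonRegPrIntLS2BetaRelativeHstepHjBkg
import HarnessLib

/-!
# S2β · letter (D♮)∕(D-stage) REL-TEL, the (C)-half — THE RELATIVE `hstep` ∕ `hj` PAIR OF ONE LEVEL, HISTORY-RADIUS EDITION (WINDOW-FREE):
# ✓∕⧗`relOneLevelStep_hist` packaged for ✓p825006 `relKeyLemma_torus_of_step` exactly as ✓p826622 `relHstep_hj_arc` packages ✓p826203 — TWO local data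
# `β_W` (loops), `β_A` (open transports), TWO suppliers, but NO window sups: `κ_W := 1.4·10⁶·((d+2)L)²θ` (history size, in front of the LOOP datum only),
# `κ_A := 7·10⁵·((d+2)L)²θ₀` (BKG); the `ℓ²` source `ε·‖δ‖₂ + η·‖bdev‖₂` with `ε = (κ_W·cWε + κ_A·cAε)·√N_□`, `η = (κ_W·cWβ + κ_A·cAβ + 5L³θ₀)·√N_b` —
# `η ∝ θ₀` as soon as the loop supplier's bdev coefficient `cWβ ∝ θ₀` (px21 g23 ✓`dist1_loopHol_rel_le_local_SU`)

Cell `ym3-torus` (rung R3 = continuum `SU(2)` Yang–Mills on the three-torus — NOT d = 4, NOT infinite volume, NOT a mass gap, NOT Clay).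
Width seat «width 10» `ym3-torus-px10` (gen 24), FREE px helper on crux `stmt-QuantumFields-20520`, count-neutral, DEFINITION-FREE; own-risk brick of the px10 lane
(the KEYREL supplier road, UV3-NODE §82.7).  Proof = ✓p826622's with the linearisation step deleted (the junk of ✓∕⧗`relOneLevelStep_hist` is already linear in
`β_W, β_A`): (hstep) at `γ := Σ_{fwd-near}bdev`; (hj) Minkowski + the two Schur bounds (bonds ✓p824969 `fineBond_nbhd3_schur`, plaquettes ✓p817170 `nbhd_schur`).
HONEST SCOPE.  Packaging; nothing of Bałaban's renormalisation analysis asserted; the suppliers, the BKG-TOWER letter, KEYREL, (H♭♭), (D-stage), GAP♯∘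
(`stub_uniformFibreGapOrbit`), S2β, crux 20520 and `YM3TorusSU2` are NOT proved; no registered stub is closed; the Yang–Mills mass gap is NOT proved.  Sorry-free,
axioms standard.  References: T. Bałaban, CMP **99** (1985) 75–102 [Balaban1985RegularSpaces] (Lemma 1 p.79); CMP **109** (1987) 249–301 [Balaban1987RG1] ((0.4) p.253).
-/

set_option autoImplicit false

noncomputable section

namespace Summit.QuantumFields.YangMills.Theorems.FluctuationComparisonRegPrIntLS2BetaRelativeHstepHjHist

open NormedSpace Finset
open scoped BigOperators
open Literature.MathematicalPhysics.QuantumFieldTheory.Balaban1983to89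
open Literature.MathematicalPhysics.QuantumFieldTheory.Balaban1983to89.T4Continuum
open Literature.MathematicalPhysics.QuantumFieldTheory.Balaban1983to89.AveragingRT
open Literature.MathematicalPhysics.QuantumFieldTheory.Balaban1983to89.BlockAveraging
open Literature.MathematicalPhysics.QuantumFieldTheory.Balaban1983to89.ExpMeanLog (expMeanLogSU deltaSU)
open Literature.MathematicalPhysics.QuantumFieldTheory.Balaban1983to89.T4TiltOscillation (bdev)
open B10Eq47AxialChi (shiftN)
open Summit.QuantumFields.YangMills.Theorems.FluctuationComparisonRegPrIntLS2BetaRelativeOneLevelStepHist (relOneLevelStep_hist)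
open Summit.QuantumFields.YangMills.Theorems.FluctuationComparisonRegPrIntLS2BetaRelativeHstepHjBkg (fineBond_nbhd3_schur)

variable {P : Params} {j : ℕ}

/-! ## The history-radius relative `hstep` ∕ `hj` pair -/

variable {n : Type*} [Fintype n] [DecidableEq n] [Nonempty n]

/-- ★★★ **THE RELATIVE `hstep` ∕ `hj` PAIR, HISTORY-RADIUS EDITION (WINDOW-FREE)** (see the module docstring for the data; standing range,
`PlaqSmall θ U` with `((d+2)L)²θ ≤ 1∕800`, guard, `PlaqSmall θ₀ U₀`, `0 ≤ θ₀ ≤ θ`; no sup hypothesis on the local data). [cite: Balaban1985RegularSpaces, Lemma 1 p.79] -/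
theorem relHstep_hj_hist (hj : j + 1 ≤ P.m + P.K) (U U₀ : GaugeField P j (Matrix.specialUnitaryGroup n ℂ)) {θ θ₀ : ℝ} (hθ00 : 0 ≤ θ₀) (hθ₀θ : θ₀ ≤ θ)
    (hθ : (((P.d + 2) * P.L : ℕ) : ℝ) ^ 2 * θ ≤ 1 / 800) (hδ : (((P.d + 2) * P.L : ℕ) : ℝ) ^ 2 / 4 * θ < deltaSU n)
    (hU : PlaqSmall θ U) (hU₀ : PlaqSmall θ₀ U₀) (βW βA : Plaq P (j + 1) → ℝ) (hβW0 : ∀ Q, 0 ≤ βW Q) (hβA0 : ∀ Q, 0 ≤ βA Q)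
    {cWβ cWε cAβ cAε : ℝ} (hcWβ : 0 ≤ cWβ) (hcWε : 0 ≤ cWε) (hcAβ : 0 ≤ cAβ) (hcAε : 0 ≤ cAε)
    (hW : ∀ (Q : Plaq P (j + 1)) (c : PBond P (j + 1)), (c = ⟨Q.src, Q.μ⟩ ∨ c = ⟨Q.src.shift Q.μ, Q.ν⟩ ∨ c = ⟨Q.src.shift Q.ν, Q.μ⟩ ∨ c = ⟨Q.src, Q.ν⟩) →
      ∀ i, dist1 ((loopHol U₀ c i)⁻¹ * loopHol U c i) ≤ βW Q)
    (hA : ∀ (Q : Plaq P (j + 1)) (c : PBond P (j + 1)), (c = ⟨Q.src, Q.μ⟩ ∨ c = ⟨Q.src.shift Q.μ, Q.ν⟩ ∨ c = ⟨Q.src.shift Q.ν, Q.μ⟩ ∨ c = ⟨Q.src, Q.ν⟩) →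
      dist1 ((axialAvg U₀ c)⁻¹ * axialAvg U c) ≤ βA Q)
    (hS : ∀ (Q : Plaq P (j + 1)) (i : Idx P),
      dist1 ((holAt U₀ (walk (emb Q.src) (stairWord i.2.1 (off i.1))))⁻¹ * holAt U (walk (emb Q.src) (stairWord i.2.1 (off i.1)))) ≤ βA Q)
    (hβWsupp : ∀ Q : Plaq P (j + 1), βW Q ≤ cWβ * ∑ c ∈ Finset.univ.filter (fun c : PBond P j => ∀ κ, blockOf c.src κ = Q.src κ ∨ blockOf c.src κ = Q.src κ + 1 ∨
      blockOf c.src κ = Q.src κ - 1), dist1 (bdev U U₀ c) +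
      cWε * ∑ q ∈ Finset.univ.filter (fun q : Plaq P j => ∀ κ, blockOf q.src κ = Q.src κ ∨ blockOf q.src κ = Q.src κ + 1 ∨
      blockOf q.src κ = Q.src κ - 1), dist1 ((GaugeField.plaqHol U₀ q)⁻¹ * GaugeField.plaqHol U q))
    (hβAsupp : ∀ Q : Plaq P (j + 1), βA Q ≤ cAβ * ∑ c ∈ Finset.univ.filter (fun c : PBond P j => ∀ κ, blockOf c.src κ = Q.src κ ∨ blockOf c.src κ = Q.src κ + 1 ∨
      blockOf c.src κ = Q.src κ - 1), dist1 (bdev U U₀ c) +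
      cAε * ∑ q ∈ Finset.univ.filter (fun q : Plaq P j => ∀ κ, blockOf q.src κ = Q.src κ ∨ blockOf q.src κ = Q.src κ + 1 ∨
      blockOf q.src κ = Q.src κ - 1), dist1 ((GaugeField.plaqHol U₀ q)⁻¹ * GaugeField.plaqHol U q)) :
    (∀ Q : Plaq P (j + 1), dist1 ((GaugeField.plaqHol (avgFun (expMeanLogSU (n := n)) U₀) Q)⁻¹ * GaugeField.plaqHol (avgFun (expMeanLogSU (n := n)) U) Q) ≤
      (1 + 26 * ((((P.d + 2) * P.L : ℕ) : ℝ) ^ 2 * θ)) *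
          ∑ p : Plaq P j, ((P.L : ℝ) ^ P.d)⁻¹ * (((block Q.src).filter (fun x : Site P j => p.μ = Q.μ ∧ p.ν = Q.ν ∧
            ∃ a ∈ range P.L, ∃ b ∈ range P.L, p.src = shiftN (shiftN x Q.μ a) Q.ν b)).card : ℝ) *
            dist1 ((GaugeField.plaqHol U₀ p)⁻¹ * GaugeField.plaqHol U p) +
        ((1400000 * ((((P.d + 2) * P.L : ℕ) : ℝ) ^ 2 * θ)) * βW Q + (700000 * ((((P.d + 2) * P.L : ℕ) : ℝ) ^ 2 * θ₀)) * βA Q +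
          5 * (P.L : ℝ) ^ 3 * θ₀ * ∑ c ∈ Finset.univ.filter (fun c : PBond P j => ∀ κ, blockOf c.src κ = Q.src κ ∨ blockOf c.src κ = Q.src κ + 1),
            dist1 (bdev U U₀ c))) ∧
    √(∑ Q : Plaq P (j + 1), ((1400000 * ((((P.d + 2) * P.L : ℕ) : ℝ) ^ 2 * θ)) * βW Q + (700000 * ((((P.d + 2) * P.L : ℕ) : ℝ) ^ 2 * θ₀)) * βA Q +
          5 * (P.L : ℝ) ^ 3 * θ₀ * ∑ c ∈ Finset.univ.filter (fun c : PBond P j => ∀ κ, blockOf c.src κ = Q.src κ ∨ blockOf c.src κ = Q.src κ + 1),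
            dist1 (bdev U U₀ c)) ^ 2) ≤
      ((1400000 * ((((P.d + 2) * P.L : ℕ) : ℝ) ^ 2 * θ)) * cWε + (700000 * ((((P.d + 2) * P.L : ℕ) : ℝ) ^ 2 * θ₀)) * cAε) * √(((3 ^ P.d * P.L ^ P.d * P.d ^ 2 : ℕ) : ℝ) * ((3 ^ P.d * P.d ^ 2 : ℕ) : ℝ)) *
          √(∑ q : Plaq P j, dist1 ((GaugeField.plaqHol U₀ q)⁻¹ * GaugeField.plaqHol U q) ^ 2) +
      ((1400000 * ((((P.d + 2) * P.L : ℕ) : ℝ) ^ 2 * θ)) * cWβ + (700000 * ((((P.d + 2) * P.L : ℕ) : ℝ) ^ 2 * θ₀)) * cAβ + 5 * (P.L : ℝ) ^ 3 * θ₀) *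
        √(((3 ^ P.d * P.L ^ P.d * P.d : ℕ) : ℝ) * ((3 ^ P.d * P.d ^ 2 : ℕ) : ℝ)) * √(∑ c : PBond P j, dist1 (bdev U U₀ c) ^ 2) := by
  classical
  have hθ0 : 0 ≤ θ := hθ00.trans hθ₀θ
  set T₀ : ℝ := (((P.d + 2) * P.L : ℕ) : ℝ) ^ 2 * θ₀ with hT₀
  set T : ℝ := (((P.d + 2) * P.L : ℕ) : ℝ) ^ 2 * θ with hT
  have hT0 : 0 ≤ T₀ := by positivity
  have hT0' : 0 ≤ T := by positivity
  have hL3 : 0 ≤ (P.L : ℝ) ^ 3 * θ₀ := by positivity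
  set κW : ℝ := 1400000 * T with hκW
  set κA : ℝ := 700000 * T₀ with hκA
  have hκW0 : 0 ≤ κW := by positivity
  have hκA0 : 0 ≤ κA := by positivity
  -- the per-Q forward-near and 3-near sums of `g`, and the 3-near sums of `f`
  set g : PBond P j → ℝ := fun c => dist1 (bdev U U₀ c) with hg
  have hg0 : ∀ c, 0 ≤ g c := fun c => GaugeGroup.dist1_nonneg _
  set N2 : Plaq P (j + 1) → ℝ := fun Q => ∑ c ∈ Finset.univ.filter (fun c : PBond P j => ∀ κ, blockOf c.src κ = Q.src κ ∨ blockOf c.src κ = Q.src κ + 1), g c with hN2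
  set N3 : Plaq P (j + 1) → ℝ := fun Q => ∑ c ∈ Finset.univ.filter (fun c : PBond P j => ∀ κ, blockOf c.src κ = Q.src κ ∨ blockOf c.src κ = Q.src κ + 1 ∨
      blockOf c.src κ = Q.src κ - 1), g c with hN3
  set fδ : Plaq P j → ℝ := fun q => dist1 ((GaugeField.plaqHol U₀ q)⁻¹ * GaugeField.plaqHol U q) with hfδ
  have hfδ0 : ∀ q, 0 ≤ fδ q := fun q => GaugeGroup.dist1_nonneg _
  set M3 : Plaq P (j + 1) → ℝ := fun Q => ∑ q ∈ Finset.univ.filter (fun q : Plaq P j => ∀ κ, blockOf q.src κ = Q.src κ ∨ blockOf q.src κ = Q.src κ + 1 ∨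
      blockOf q.src κ = Q.src κ - 1), fδ q with hM3
  have hN2le : ∀ Q, N2 Q ≤ N3 Q := fun Q => by
    refine Finset.sum_le_sum_of_subset_of_nonneg (fun c hc => ?_) (fun c _ _ => hg0 c)
    rw [Finset.mem_filter] at hc ⊢
    exact ⟨hc.1, fun κ => (hc.2 κ).elim Or.inl (fun h => Or.inr (Or.inl h))⟩
  have hN20 : ∀ Q, 0 ≤ N2 Q := fun Q => Finset.sum_nonneg fun c _ => hg0 c
  have hN30 : ∀ Q, 0 ≤ N3 Q := fun Q => Finset.sum_nonneg fun c _ => hg0 c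
  have hM30 : ∀ Q, 0 ≤ M3 Q := fun Q => Finset.sum_nonneg fun q _ => hfδ0 q
  refine ⟨fun Q => ?_, ?_⟩
  · -- (hstep): ✓∕⧗`relOneLevelStep_hist` with `γ := N2 Q` (its junk is already linear in the local data)
    have h := relOneLevelStep_hist hj U U₀ hθ00 hθ₀θ hθ hδ hU hU₀ Q (hβW0 Q) (hβA0 Q) (hW Q) (hA Q) (hS Q)
      (γ := N2 Q) (fun c hc => Finset.single_le_sum (f := g) (fun c' _ => hg0 c') (Finset.mem_filter.mpr ⟨Finset.mem_univ c, hc⟩))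
    rw [hκW, hκA, hT₀, hT]
    linarith only [h]
  · -- (hj): `j Q ≤ A·N3 Q + B·M3 Q`, Minkowski, then the two Schur bounds (bonds: ✓p824969 §1; plaquettes: ✓p817170)
    set A : ℝ := κW * cWβ + κA * cAβ + 5 * (P.L : ℝ) ^ 3 * θ₀ with hA'
    set B : ℝ := κW * cWε + κA * cAε with hB
    have hA0 : 0 ≤ A := by positivity
    have hB0 : 0 ≤ B := by positivity
    have hjQ : ∀ Q, κW * βW Q + κA * βA Q + 5 * (P.L : ℝ) ^ 3 * θ₀ * N2 Q ≤ A * N3 Q + B * M3 Q := fun Q => by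
      have h1 := mul_le_mul_of_nonneg_left (hβWsupp Q) hκW0
      have h2 := mul_le_mul_of_nonneg_left (hβAsupp Q) hκA0
      have h3 := mul_le_mul_of_nonneg_left (hN2le Q) hL3
      calc κW * βW Q + κA * βA Q + 5 * (P.L : ℝ) ^ 3 * θ₀ * N2 Q
          ≤ κW * (cWβ * N3 Q + cWε * M3 Q) + κA * (cAβ * N3 Q + cAε * M3 Q) + 5 * ((P.L : ℝ) ^ 3 * θ₀) * N3 Q := by linarith
        _ = A * N3 Q + B * M3 Q := by rw [hA', hB]; ring
    have hj0 : ∀ Q, 0 ≤ κW * βW Q + κA * βA Q + 5 * (P.L : ℝ) ^ 3 * θ₀ * N2 Q := fun Q => by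
      have := hβW0 Q; have := hβA0 Q; have := hN20 Q; positivity
    have hMink := FluctuationComparisonRegPrIntLS2BetaKeyLemmaSkeleton.sqrt_sum_sq_le_of_le_add Finset.univ
      (fun Q => κW * βW Q + κA * βA Q + 5 * (P.L : ℝ) ^ 3 * θ₀ * N2 Q) (fun Q => A * N3 Q) (fun Q => B * M3 Q) (fun Q _ => hj0 Q) (fun Q _ => hjQ Q)
    have hb1 : ∑ Q : Plaq P (j + 1), (A * N3 Q) ^ 2 = A ^ 2 * ∑ Q : Plaq P (j + 1), (N3 Q) ^ 2 := by
      rw [Finset.mul_sum]; exact Finset.sum_congr rfl fun Q _ => by ring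
    have hb2 := fineBond_nbhd3_schur hj g
    have hSb : √(∑ Q : Plaq P (j + 1), (A * N3 Q) ^ 2) ≤ A * √(((3 ^ P.d * P.L ^ P.d * P.d : ℕ) : ℝ) * ((3 ^ P.d * P.d ^ 2 : ℕ) : ℝ)) * √(∑ c : PBond P j, g c ^ 2) := by
      rw [hb1]
      calc √(A ^ 2 * ∑ Q : Plaq P (j + 1), (N3 Q) ^ 2) ≤ √(A ^ 2 * ((((3 ^ P.d * P.L ^ P.d * P.d : ℕ) : ℝ) * ((3 ^ P.d * P.d ^ 2 : ℕ) : ℝ)) * ∑ c : PBond P j, g c ^ 2)) :=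
            Real.sqrt_le_sqrt (mul_le_mul_of_nonneg_left hb2 (sq_nonneg _))
        _ = A * √(((3 ^ P.d * P.L ^ P.d * P.d : ℕ) : ℝ) * ((3 ^ P.d * P.d ^ 2 : ℕ) : ℝ)) * √(∑ c : PBond P j, g c ^ 2) := by
            rw [Real.sqrt_mul (sq_nonneg _), Real.sqrt_sq hA0, Real.sqrt_mul (by positivity)]; ring
    have hp1 : ∑ Q : Plaq P (j + 1), (B * M3 Q) ^ 2 = B ^ 2 * ∑ Q : Plaq P (j + 1), (M3 Q) ^ 2 := by
      rw [Finset.mul_sum]; exact Finset.sum_congr rfl fun Q _ => by ring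
    have hp2 := FluctuationComparisonRegPrIntLS2BetaNeighbourhoodKernelTorus.nbhd_schur hj fδ
    have hSp : √(∑ Q : Plaq P (j + 1), (B * M3 Q) ^ 2) ≤ B * √(((3 ^ P.d * P.L ^ P.d * P.d ^ 2 : ℕ) : ℝ) * ((3 ^ P.d * P.d ^ 2 : ℕ) : ℝ)) * √(∑ q : Plaq P j, fδ q ^ 2) := by
      rw [hp1]
      calc √(B ^ 2 * ∑ Q : Plaq P (j + 1), (M3 Q) ^ 2) ≤ √(B ^ 2 * ((((3 ^ P.d * P.L ^ P.d * P.d ^ 2 : ℕ) : ℝ) * ((3 ^ P.d * P.d ^ 2 : ℕ) : ℝ)) * ∑ q : Plaq P j, fδ q ^ 2)) :=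
            Real.sqrt_le_sqrt (mul_le_mul_of_nonneg_left hp2 (sq_nonneg _))
        _ = B * √(((3 ^ P.d * P.L ^ P.d * P.d ^ 2 : ℕ) : ℝ) * ((3 ^ P.d * P.d ^ 2 : ℕ) : ℝ)) * √(∑ q : Plaq P j, fδ q ^ 2) := by
            rw [Real.sqrt_mul (sq_nonneg _), Real.sqrt_sq hB0, Real.sqrt_mul (by positivity)]; ring
    have hfin := hMink.trans (add_le_add hSb hSp)
    rw [hA', hB, hκW, hκA, hT₀, hT] at hfin
    linarith [hfin]

end Summit.QuantumFields.YangMills.Theorems.FluctuationComparisonRegPrIntLS2BetaRelativeHstepHjHist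

end
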